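import Summits.QuantumFields.YangMills.Theorems.UniversalDetectorReflectDefect
import Summits.QuantumFields.YangMills.Theorems.UniversalDetectorQ2NearKernel
import Summits.QuantumFields.YangMills.Theorems.UniversalDetectorBlindLatticeExtraction

/-!
# Route `UniversalDetector`, LINE «blind detector» (item stmt-QuantumFields-24148 `BlindDetector`, stub
# `BlindSeqExtraction`): the lattice-kernel inputs of the blind extraction

Fleet lead `ym-spine-19353-p1` g26 (crux `BalabanLadder.NT`, LINE g11-1 of ym-idea-8).  The stub's hypotheses are
per-orientation-pair (36 plane kernels `ker6 p q`) and sequential; this file turns them into the inputs of the blind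
analysis files (`UniversalDetectorBlindLatticeExtraction`, `UniversalDetectorBlindQ2Template`):

* `seqBound_sum`, `seqAxis_sum` — bounds / axis moduli of finitely many kernels add up to those of their sum
  (the full kernel is the sum of the 36 plane kernels, `cov_dens_zero_eq_sum`);
* `reflect_defect_of_axis` — the time-reflection defect `|ker(z) − ker(ϑz)|` is at most `s Σ_{pq} Λ_pq` when each
  plane kernel is axis-Lipschitz along the TIME axis off the slab `|s z₀| < η/2` (the reflected density hangs one unit
  below the mirror site: tree `abs_cov_dens_sub_cov_dens_siteReflect_le`; no time wrap `|z₀| + 1 ≤ L`);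
* `rp_step_bound_of_axis` — the one-step defect bound `E = s⁸ Λ s` at reflected charged pairs (the `hstep` of the
  tree's `Q2_thetaTest_ge_neg_defect`), from the time-axis modulus alone (periodic representatives, tree
  `cov_plane_cRep`, `cRep_proj_sub_single`);
* `Q2_nearKernel_blind` — the `hnear` input of `tendsto_latticeDoubleSum_blind` from the orthant-annulus
  approximation clause of the extraction.

Lattice bookkeeping; no summit, rung or crux statement is proved here. [folklore]
-/

set_option autoImplicit false

noncomputable section

namespace Summit.QuantumFields.YangMills.Cruxes.UniversalDetectorBlindExtraction

open scoped SchwartzMap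
open MeasureTheory Filter Topology Finset
open Literature.MathematicalPhysics.QuantumFieldTheory Literature.MathematicalPhysics.QuantumLattice
  Literature.Probability.LatticeModels
open Summit.QuantumFields.YangMills.Cruxes.OSLegsFromFemtoAndGap.DlrCollarTransfer
open Summit.QuantumFields.YangMills.Cruxes.UniversalDetectorPlaneTight

/-! ### Finitely many kernels: bounds and axis moduli add up -/

/-- **Bounds add up.**  Sequential bounds off the `η`-ball for finitely many kernel families give one for their
sum. [folklore] -/
theorem seqBound_sum {σ : Type*} [Fintype σ] (s : ℕ → ℝ) (L : ℕ → ℕ) (g6 : ℕ → σ → Site 4 → ℝ)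
    (g : ℕ → Site 4 → ℝ) (hsplit : ∀ m z, g m z = ∑ t : σ, g6 m t z)
    (hB : ∀ t : σ, ∀ η : ℝ, 0 < η → ∃ (C : ℝ) (k₀ : ℕ), ∀ m, k₀ ≤ m → ∀ z ∈ box 4 (L m),
      η ≤ ‖s m • siteToE z‖ → |g6 m t z| ≤ C) :
    ∀ η : ℝ, 0 < η → ∃ (C : ℝ) (k₀ : ℕ), ∀ m, k₀ ≤ m → ∀ z ∈ box 4 (L m),
      η ≤ ‖s m • siteToE z‖ → |g m z| ≤ C := by
  classical
  intro η hη
  choose C k₀ hC using fun t : σ => hB t η hη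
  refine ⟨∑ t, C t, univ.sup k₀, fun m hm z hz hzη => ?_⟩
  rw [hsplit]
  refine (abs_sum_le_sum_abs _ _).trans (sum_le_sum fun t _ => hC t m ?_ z hz hzη)
  exact (Finset.le_sup (mem_univ t)).trans hm

/-- **Axis moduli add up.**  Sequential axis moduli (the shape of `hLong`, one slope `Λ_t` per family, common side
conditions) for finitely many kernel families give one for their sum, with slope `Σ Λ_t`. [folklore] -/
theorem seqAxis_sum {σ : Type*} [Fintype σ] (s : ℕ → ℝ) (L : ℕ → ℕ) (g6 : ℕ → σ → Site 4 → ℝ)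
    (g : ℕ → Site 4 → ℝ) (hsplit : ∀ m z, g m z = ∑ t : σ, g6 m t z) (η τ : ℝ)
    (hAx : ∀ t : σ, ∃ (Λ : ℝ) (k₀ : ℕ), ∀ m, k₀ ≤ m → ∀ (k : Fin 4) (z : Site 4) (n : ℕ),
      (∀ j : ℕ, j ≤ n → z + Pi.single k (j : ℤ) ∈ box 4 (L m) ∧
        η ≤ ‖s m • siteToE (z + Pi.single k (j : ℤ))‖ ∧ τ ≤ |s m * ((z k : ℝ) + j)|) →
      |g6 m t z - g6 m t (z + Pi.single k (n : ℤ))| ≤ Λ * (s m * n)) :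
    ∃ (Λ : ℝ) (k₀ : ℕ), ∀ m, k₀ ≤ m → ∀ (k : Fin 4) (z : Site 4) (n : ℕ),
      (∀ j : ℕ, j ≤ n → z + Pi.single k (j : ℤ) ∈ box 4 (L m) ∧
        η ≤ ‖s m • siteToE (z + Pi.single k (j : ℤ))‖ ∧ τ ≤ |s m * ((z k : ℝ) + j)|) →
      |g m z - g m (z + Pi.single k (n : ℤ))| ≤ Λ * (s m * n) := by
  classical
  choose Λ k₀ hΛ using hAx
  refine ⟨∑ t, Λ t, univ.sup k₀, fun m hm k z n hpath => ?_⟩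
  rw [hsplit, hsplit, ← sum_sub_distrib, sum_mul]
  refine (abs_sum_le_sum_abs _ _).trans (sum_le_sum fun t _ => hΛ t m ?_ k z n hpath)
  exact (Finset.le_sup (mem_univ t)).trans hm

/-! ### The time-reflection defect from the time-axis modulus -/

section Gauge

variable {G : Type} [Group G] [TopologicalSpace G] [IsTopologicalGroup G] [CompactSpace G]
  [MeasurableSpace G] [BorelSpace G] (r : LatticeRep G)

omit [Group G] [TopologicalSpace G] [IsTopologicalGroup G] [CompactSpace G] [MeasurableSpace G] [BorelSpace G] r in
/-- `s |v 0| ≤ ‖s v‖` (`s ≥ 0`). [folklore] -/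
theorem smul_abs_zero_le_norm {s : ℝ} (hs : 0 ≤ s) (v : Site 4) : s * |(v 0 : ℝ)| ≤ ‖s • siteToE v‖ := by
  rw [norm_smul, Real.norm_of_nonneg hs]
  gcongr
  simpa [siteToE_apply, Real.norm_eq_abs] using PiLp.norm_apply_le (siteToE v) 0

/-- **Time-reflection defect from the time-axis modulus.**  At one coupling (`s = a(β) > 0`, `2s ≤ η`): if every
plane-resolved rescaled kernel has the axis modulus of slope `Λ_pq ≥ 0` along box segments off the `η/2`-ball whose
moving coordinate stays outside `|s z_k| < η/2`, then for `z ∈ box 4 L` with `|z₀| + 1 ≤ L` and `η ≤ |s z₀|`,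
`|ker(z) − ker(ϑz)| ≤ s · Σ_{p,q} Λ_pq`. [folklore] -/
theorem reflect_defect_of_axis (β : ℝ) (L : ℕ) {s η : ℝ} (hs : 0 < s) (hsη : 2 * s ≤ η)
    (Λ : {q : Fin 4 × Fin 4 // q.1 < q.2} → {q : Fin 4 × Fin 4 // q.1 < q.2} → ℝ) (hΛ : ∀ p q, 0 ≤ Λ p q)
    (hAx : ∀ (p q : {q : Fin 4 × Fin 4 // q.1 < q.2}) (k : Fin 4) (z : Site 4) (n : ℕ),
      (∀ j : ℕ, j ≤ n → z + Pi.single k (j : ℤ) ∈ box 4 L ∧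
        η / 2 ≤ ‖s • siteToE (z + Pi.single k (j : ℤ))‖ ∧ η / 2 ≤ |s * ((z k : ℝ) + j)|) →
      |s⁻¹ ^ 8 * (torusE G r β L (fun U => plane G r p.1 0 U * plane G r q.1 z U) -
          torusE G r β L (plane G r p.1 0) * torusE G r β L (plane G r q.1 z)) -
        s⁻¹ ^ 8 * (torusE G r β L (fun U => plane G r p.1 0 U * plane G r q.1 (z + Pi.single k (n : ℤ)) U) -
          torusE G r β L (plane G r p.1 0) * torusE G r β L (plane G r q.1 (z + Pi.single k (n : ℤ))))| ≤
        Λ p q * (s * n))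
    {z : Site 4} (hz : z ∈ box 4 L) (hz0 : |z 0| + 1 ≤ (L : ℤ)) (hzη : η ≤ |s * (z 0 : ℝ)|) :
    |s⁻¹ ^ 8 * (torusE G r β L (fun V => dens G r 0 V * dens G r z V) -
        torusE G r β L (dens G r 0) * torusE G r β L (dens G r z)) -
      s⁻¹ ^ 8 * (torusE G r β L (fun V => dens G r 0 V * dens G r (siteReflect z) V) -
        torusE G r β L (dens G r 0) * torusE G r β L (dens G r (siteReflect z)))| ≤
      s * ∑ p : {q : Fin 4 × Fin 4 // q.1 < q.2}, ∑ q : {q : Fin 4 × Fin 4 // q.1 < q.2}, Λ p q := by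
  -- the time coordinate along the unit segments at `ϑz` and `ϑz - e₀` stays outside `|s t| < η/2`
  have hcoord : ∀ c : ℤ, (c = -z 0 ∨ c = -z 0 - 1) → ∀ j : ℕ, j ≤ 1 → η / 2 ≤ |s * ((c : ℝ) + j)| := by
    intro c hc j hj
    have hj' : (j : ℝ) ≤ 1 := by exact_mod_cast hj
    have hj0 : (0 : ℝ) ≤ j := Nat.cast_nonneg j
    have habs : |s * (z 0 : ℝ)| = s * |(z 0 : ℝ)| := by rw [abs_mul, abs_of_pos hs]
    rw [habs] at hzη
    have key : s * |(z 0 : ℝ)| - s ≤ |s * ((c : ℝ) + j)| := by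
      rw [abs_mul, abs_of_pos hs, ← mul_sub_one]
      refine mul_le_mul_of_nonneg_left ?_ hs.le
      rcases hc with hc | hc
      · rw [hc]; push_cast
        have := abs_sub_abs_le_abs_sub (-(z 0 : ℝ)) (-(j : ℝ))
        rw [abs_neg, abs_neg, abs_of_nonneg hj0, sub_neg_eq_add] at this
        linarith
      · rw [hc]; push_cast
        have := abs_sub_abs_le_abs_sub (-(z 0 : ℝ)) (1 - (j : ℝ))
        rw [abs_neg, abs_of_nonneg (by linarith : (0 : ℝ) ≤ 1 - j),
          show -(z 0 : ℝ) - (1 - j) = -(z 0 : ℝ) - 1 + j by ring] at this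
        linarith
    linarith
  -- one admissible unit time step at the reflected point costs at most `s⁸ Λ_pq s`
  have key : ∀ p q : {q : Fin 4 × Fin 4 // q.1 < q.2}, ∀ (w : Site 4),
      (w = siteReflect z ∨ w = siteReflect z - Pi.single 0 1) →
      w ∈ box 4 L → w + Pi.single 0 (1 : ℤ) ∈ box 4 L →
      |(torusE G r β L (fun V => plane G r p.1 0 V * plane G r q.1 (w + Pi.single 0 (1 : ℤ)) V) -
          torusE G r β L (plane G r p.1 0) * torusE G r β L (plane G r q.1 (w + Pi.single 0 (1 : ℤ)))) -
        (torusE G r β L (fun V => plane G r p.1 0 V * plane G r q.1 w V) -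
          torusE G r β L (plane G r p.1 0) * torusE G r β L (plane G r q.1 w))| ≤ s ^ 8 * (Λ p q * s) := by
    intro p q w hw hwb hwb'
    have hw0 : w 0 = -z 0 ∨ w 0 = -z 0 - 1 := by
      rcases hw with hw | hw
      · left; rw [hw, siteReflect_apply_zero]
      · right; rw [hw, Pi.sub_apply, siteReflect_apply_zero, Pi.single_eq_same]
    have hpath : ∀ j : ℕ, j ≤ 1 → w + Pi.single 0 (j : ℤ) ∈ box 4 L ∧
        η / 2 ≤ ‖s • siteToE (w + Pi.single 0 (j : ℤ))‖ ∧ η / 2 ≤ |s * ((w 0 : ℝ) + j)| := by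
      intro j hj
      have hc := hcoord (w 0) hw0 j hj
      have hbox : w + Pi.single 0 (j : ℤ) ∈ box 4 L := by
        rcases Nat.le_one_iff_eq_zero_or_eq_one.1 hj with rfl | rfl
        · simp only [Nat.cast_zero, Pi.single_zero, add_zero]; exact hwb
        · simp only [Nat.cast_one]; exact hwb'
      refine ⟨hbox, le_trans hc ?_, hc⟩
      have hw0j : ((w + Pi.single 0 (j : ℤ) : Site 4) 0) = w 0 + j := by simp
      have h1 : |s * ((w 0 : ℝ) + j)| = s * |(((w + Pi.single 0 (j : ℤ) : Site 4) 0 : ℤ) : ℝ)| := by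
        rw [hw0j, abs_mul, abs_of_pos hs]; push_cast; rfl
      rw [h1]
      exact smul_abs_zero_le_norm hs.le _
    have h := hAx p q 0 w 1 hpath
    simp only [Nat.cast_one, mul_one] at h
    rw [abs_sub_comm, abs_sub_eq_pow_mul_abs_sub_scaled hs.ne']
    exact mul_le_mul_of_nonneg_left h (by positivity)
  have hθ : siteReflect z ∈ box 4 L :=
    Summit.QuantumFields.YangMills.Cruxes.UniversalDetectorPlaneTight.siteReflect_mem_box hz
  -- the plane-kernel differences of `abs_cov_dens_sub_cov_dens_siteReflect_le` are such steps (or vanish)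
  have hb := abs_cov_dens_sub_cov_dens_siteReflect_le r β L z (fun p q => s ^ 8 * (Λ p q * s)) (by
    intro p q
    by_cases hp : p.1.1 = 0 <;> by_cases hq : q.1.1 = 0 <;> simp only [hp, hq, if_true, if_false]
    · rw [sub_self, add_zero, sub_self, abs_zero]; exact mul_nonneg (by positivity) (mul_nonneg (hΛ p q) hs.le)
    · rw [sub_zero]
      exact key p q (siteReflect z) (Or.inl rfl) hθ
        (siteReflect_add_mem_box hz hz0 _ (by simp) (fun i hi => by simp [Pi.single_eq_of_ne hi]))
    · rw [zero_sub, ← sub_eq_add_neg]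
      have hwb : siteReflect z - Pi.single 0 1 ∈ box 4 L := by
        have := siteReflect_add_mem_box hz hz0 (-(Pi.single 0 1)) (by simp) (fun i hi => by simp [Pi.single_eq_of_ne hi])
        simpa [sub_eq_add_neg] using this
      have h := key p q (siteReflect z - Pi.single 0 1) (Or.inr rfl) hwb (by simpa using hθ)
      rw [sub_add_cancel] at h
      rwa [abs_sub_comm] at h
    · rw [sub_self, add_zero, sub_self, abs_zero]; exact mul_nonneg (by positivity) (mul_nonneg (hΛ p q) hs.le))
  -- unscale
  rw [← mul_sub, abs_mul, abs_of_pos (by positivity : (0 : ℝ) < s⁻¹ ^ 8)]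
  calc s⁻¹ ^ 8 * |(torusE G r β L (fun V => dens G r 0 V * dens G r z V) -
          torusE G r β L (dens G r 0) * torusE G r β L (dens G r z)) -
        (torusE G r β L (fun V => dens G r 0 V * dens G r (siteReflect z) V) -
          torusE G r β L (dens G r 0) * torusE G r β L (dens G r (siteReflect z)))|
      ≤ s⁻¹ ^ 8 * ∑ p : {q : Fin 4 × Fin 4 // q.1 < q.2}, ∑ q : {q : Fin 4 × Fin 4 // q.1 < q.2},
          s ^ 8 * (Λ p q * s) := mul_le_mul_of_nonneg_left hb (by positivity)
    _ = s * ∑ p : {q : Fin 4 × Fin 4 // q.1 < q.2}, ∑ q : {q : Fin 4 × Fin 4 // q.1 < q.2}, Λ p q := by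
        rw [Finset.mul_sum, Finset.mul_sum]
        refine Finset.sum_congr rfl fun p _ => ?_
        rw [Finset.mul_sum, Finset.mul_sum]
        refine Finset.sum_congr rfl fun q _ => ?_
        have h8 : s⁻¹ ^ 8 * s ^ 8 = 1 := by rw [← mul_pow, inv_mul_cancel₀ hs.ne', one_pow]
        calc s⁻¹ ^ 8 * (s ^ 8 * (Λ p q * s)) = (s⁻¹ ^ 8 * s ^ 8) * (Λ p q * s) := by ring
          _ = s * Λ p q := by rw [h8]; ring

/-! ### The one-step defect at reflected charged pairs from the time-axis modulus -/

/-- **One-step defect bound from the time-axis modulus.**  At one coupling (`s = a(β) > 0`), if the plane-resolved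
rescaled kernel for the orientations `p, q` has the axis modulus of slope `Λ ≥ 0` along box segments off the
`2t₀`-ball whose moving coordinate stays outside `|s z_k| < 2t₀`, then for every pair of lattice points of the slab
`t₀ ≤ s x₀, s y₀ ≤ T` (`0 < t₀`, `2T + s ≤ sL`) the one-step time difference of the plane-resolved truncated kernel
at the reflected pair is at most `s⁸ · Λ s`. [folklore] -/
theorem rp_step_bound_of_axis (β : ℝ) (L : ℕ) {s t₀ T : ℝ} (hs : 0 < s) (ht₀ : 0 < t₀)
    (hLT : 2 * T + s ≤ s * L) (p q : Fin 4 × Fin 4) {Λ : ℝ} (hΛ : 0 ≤ Λ)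
    (hAx : ∀ (k : Fin 4) (z : Site 4) (n : ℕ),
      (∀ j : ℕ, j ≤ n → z + Pi.single k (j : ℤ) ∈ box 4 L ∧
        2 * t₀ ≤ ‖s • siteToE (z + Pi.single k (j : ℤ))‖ ∧ 2 * t₀ ≤ |s * ((z k : ℝ) + j)|) →
      |s⁻¹ ^ 8 * (torusE G r β L (fun U => plane G r p 0 U * plane G r q z U) -
          torusE G r β L (plane G r p 0) * torusE G r β L (plane G r q z)) -
        s⁻¹ ^ 8 * (torusE G r β L (fun U => plane G r p 0 U * plane G r q (z + Pi.single k (n : ℤ)) U) -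
          torusE G r β L (plane G r p 0) * torusE G r β L (plane G r q (z + Pi.single k (n : ℤ))))| ≤
        Λ * (s * n))
    {x y : Site 4} (hx : t₀ ≤ s * (x 0 : ℝ)) (hx' : s * (x 0 : ℝ) ≤ T) (hy : t₀ ≤ s * (y 0 : ℝ))
    (hy' : s * (y 0 : ℝ) ≤ T) :
    |(torusE G r β L (fun V => plane G r p 0 V * plane G r q (siteReflect x - y) V) -
        torusE G r β L (plane G r p 0) * torusE G r β L (plane G r q (siteReflect x - y))) -
      (torusE G r β L (fun V => plane G r p 0 V *
          plane G r q ((if q.1 = 0 then siteReflect x - Pi.single 0 1 else siteReflect x) - y) V) -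
        torusE G r β L (plane G r p 0) *
          torusE G r β L (plane G r q ((if q.1 = 0 then siteReflect x - Pi.single 0 1 else siteReflect x) - y)))|
      ≤ s ^ 8 * (Λ * s) := by
  by_cases hq : q.1 = 0
  swap
  · rw [if_neg hq, sub_self, abs_zero]; positivity
  rw [if_pos hq, show siteReflect x - Pi.single 0 1 - y = (siteReflect x - y) - Pi.single 0 1 from sub_right_comm _ _ _]
  set z : Site 4 := siteReflect x - y with hzdef
  -- integer time bounds (no time wrap)
  have hx0 : (0 : ℝ) < x 0 := by
    by_contra h; push Not at h; nlinarith
  have hy0 : (0 : ℝ) < y 0 := by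
    by_contra h; push Not at h; nlinarith
  have hsum : (x 0 : ℝ) + y 0 + 1 ≤ L := by
    have h1 : s * ((x 0 : ℝ) + y 0 + 1) ≤ s * L := by nlinarith
    exact le_of_mul_le_mul_left h1 hs
  have hz0 : z 0 = -x 0 - y 0 := by rw [hzdef, Pi.sub_apply, siteReflect_apply_zero]
  have hsumZ : x 0 + y 0 + 1 ≤ (L : ℤ) := by exact_mod_cast hsum
  have hx0Z : 0 < x 0 := by exact_mod_cast hx0
  have hy0Z : 0 < y 0 := by exact_mod_cast hy0
  have hzw : -(L : ℤ) ≤ z 0 ∧ z 0 ≤ L := by rw [hz0]; constructor <;> omega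
  have hzw' : -(L : ℤ) ≤ z 0 - 1 ∧ z 0 - 1 ≤ L := by rw [hz0]; constructor <;> omega
  -- centred representatives
  set zh : Site 4 := Torus.cRep (Torus.proj (2 * L + 1) z) with hzh
  set zh' : Site 4 := Torus.cRep (Torus.proj (2 * L + 1) (z - Pi.single 0 1)) with hzh'
  have hmem : zh ∈ box 4 L := cRep_proj_mem_box L z
  have hmem' : zh' ∈ box 4 L := cRep_proj_mem_box L (z - Pi.single 0 1)
  have ht : zh 0 = z 0 := cRep_proj_apply_of_mem L z 0 hzw
  have ht' : zh' 0 = z 0 - 1 := by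
    have := cRep_proj_apply_of_mem L (z - Pi.single 0 1) 0 (by simpa using hzw')
    simpa using this
  have hsub : zh - zh' = Pi.single 0 1 := cRep_proj_sub_single L z hzw hzw'
  have hstep : zh' + Pi.single 0 (1 : ℤ) = zh := by rw [← hsub]; abel
  -- time coordinates along the unit segment from `zh'` to `zh` in physical units
  have htime : ∀ j : ℕ, j ≤ 1 → 2 * t₀ ≤ |s * ((zh' 0 : ℝ) + j)| := by
    intro j hj
    have hj' : (j : ℝ) ≤ 1 := by exact_mod_cast hj
    have hj0 : (0 : ℝ) ≤ j := Nat.cast_nonneg j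
    rw [ht', hz0]; push_cast
    rw [show -(x 0 : ℝ) - y 0 - 1 + j = -((x 0 : ℝ) + y 0 + 1 - j) by ring, mul_neg, abs_neg,
      abs_of_pos (by nlinarith)]
    nlinarith
  have hpath : ∀ j : ℕ, j ≤ 1 → zh' + Pi.single 0 (j : ℤ) ∈ box 4 L ∧
      2 * t₀ ≤ ‖s • siteToE (zh' + Pi.single 0 (j : ℤ))‖ ∧ 2 * t₀ ≤ |s * ((zh' 0 : ℝ) + j)| := by
    intro j hj
    have hc := htime j hj
    have hbox : zh' + Pi.single 0 (j : ℤ) ∈ box 4 L := by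
      rcases Nat.le_one_iff_eq_zero_or_eq_one.1 hj with rfl | rfl
      · simp only [Nat.cast_zero, Pi.single_zero, add_zero]; exact hmem'
      · simp only [Nat.cast_one]; rw [hstep]; exact hmem
    refine ⟨hbox, le_trans hc ?_, hc⟩
    have hw0j : ((zh' + Pi.single 0 (j : ℤ) : Site 4) 0) = zh' 0 + j := by simp
    have h1 : |s * ((zh' 0 : ℝ) + j)| = s * |(((zh' + Pi.single 0 (j : ℤ) : Site 4) 0 : ℤ) : ℝ)| := by
      rw [hw0j, abs_mul, abs_of_pos hs]; push_cast; rfl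
    rw [h1]
    exact smul_abs_zero_le_norm hs.le _
  have hk := hAx 0 zh' 1 hpath
  simp only [Nat.cast_one, mul_one] at hk
  rw [hstep] at hk
  -- back to the unreduced arguments by periodicity
  have e1 := cov_plane_cRep r β L p q 0 z
  have e2 := cov_plane_cRep r β L p q 0 (z - Pi.single 0 1)
  rw [← hzh] at e1
  rw [← hzh'] at e2
  rw [← e1, ← e2, abs_sub_eq_pow_mul_abs_sub_scaled hs.ne', abs_sub_comm]
  exact mul_le_mul_of_nonneg_left hk (by positivity)

/-! ### The `hnear` input from the orthant-annulus approximation -/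

/-- **`hnear` of `tendsto_latticeDoubleSum_blind` from the blind extraction clause.**  Along a lattice sequence
(`s_k > 0`, `s_k L_k → ∞`), if the one-point kernels approximate `K` uniformly on every orthant annulus, then for all
`η, R, ε > 0`, eventually, for all slab-supported pairs in the ball of radius `R` whose difference has all physical
coordinates `≥ η` in size, `|s_k⁻⁸ Cov_T(dens x, dens x') − K(s_k x' − s_k x)| ≤ ε`. [folklore] -/
theorem Q2_nearKernel_blind (w₁ w₂ : 𝓢(EuclideanSpace ℝ (Fin 4), ℝ)) (K : EuclideanSpace ℝ (Fin 4) → ℝ)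
    (β : ℕ → ℝ) (L : ℕ → ℕ) (s : ℕ → ℝ) (hs : ∀ k, 0 < s k)
    (hL : Tendsto (fun k => s k * L k) atTop atTop)
    (happ : ∀ η ε : ℝ, 0 < η → 0 < ε → ∃ k₀ : ℕ, ∀ k : ℕ, k₀ ≤ k → ∀ z ∈ box 4 (L k),
      (∀ i : Fin 4, η ≤ |s k * (z i : ℝ)|) → ‖s k • siteToE z‖ ≤ η⁻¹ →
        |(s k)⁻¹ ^ 8 * (torusE G r (β k) (L k) (fun U => dens G r 0 U * dens G r z U) -
            torusE G r (β k) (L k) (dens G r 0) * torusE G r (β k) (L k) (dens G r z)) - K (s k • siteToE z)| ≤ ε) :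
    ∀ η R ε : ℝ, 0 < η → 0 < R → 0 < ε → ∀ᶠ k in atTop, ∀ x ∈ box 4 (L k), ∀ x' ∈ box 4 (L k),
      ‖s k • siteToE x‖ ≤ R → ‖s k • siteToE x'‖ ≤ R →
      w₁ (s k • siteToE x) ≠ 0 → w₂ (s k • siteToE x') ≠ 0 →
      (∀ i : Fin 4, η ≤ |(s k • siteToE x' - s k • siteToE x) i|) →
      |(s k)⁻¹ ^ 8 * (torusE G r (β k) (L k) (fun U => dens G r x U * dens G r x' U)
          - torusE G r (β k) (L k) (dens G r x) * torusE G r (β k) (L k) (dens G r x'))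
        - K (s k • siteToE x' - s k • siteToE x)| ≤ ε := by
  intro η R ε hη hR hε
  set η' : ℝ := min η (2 * R)⁻¹ with hη'def
  have hη' : 0 < η' := by positivity
  obtain ⟨k₀, hk₀⟩ := happ η' ε hη' hε
  filter_upwards [eventually_ge_atTop k₀, hL.eventually_ge_atTop (2 * R)] with k hk hkL x hx x' hx' hxR hx'R _ _ hΩ
  have hmem : x' - x ∈ box 4 (L k) := sub_mem_box_of_norm_le (hs k) hkL hxR hx'R
  rw [pairKernel_eq_translate, ← smul_siteToE_sub]
  refine hk₀ k hk (x' - x) hmem (fun i => ?_) ?_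
  · have h := hΩ i
    rw [← smul_siteToE_sub] at h
    refine (min_le_left _ _).trans (le_trans h (le_of_eq ?_))
    simp [siteToE_apply]
  · have h2R : ‖s k • siteToE (x' - x)‖ ≤ 2 * R := by
      rw [smul_siteToE_sub]
      exact (norm_sub_le _ _).trans (by linarith)
    refine h2R.trans ?_
    rw [← le_inv_comm₀ hη' (by positivity), hη'def]
    exact min_le_right _ _

end Gauge

end Summit.QuantumFields.YangMills.Cruxes.UniversalDetectorBlindExtraction

end
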